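import Mathlib
import HarnessLib
import Summits.HubbardSuperconductivity.HubbardSuperconductivity.Theorems.KLProgrammeKLRegimeEngineScaleZeroAlphaWX5
import Summits.HubbardSuperconductivity.HubbardSuperconductivity.Theorems.KLProgrammeKLRegimeEngineScaleOneDecay
import Summits.HubbardSuperconductivity.HubbardSuperconductivity.Theorems.KLProgrammeKLRegimeEngineScaleOneSpaceMoment

/-!
# Route `KLProgramme` — K3 VL child (stmt-HubbardSuperconductivity-23356), atom `stub_vl_HE1free`, LEVEL 0 («(VL)-HE1-LEVEL0», F3 + F5b):
# the `gridLabelWt`-WEIGHTED decay constant (α_w)₁ of the pulled-back cutoff-`Λ₁` covariance `S_NᵀC^K_{>Λ₁}S_N` — `hrow`/`hcol` of the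
# cutoff-`Λ₁` one-step `…EngineCutoffKernelNormsWtAt`, ASSEMBLED from the three torus sums at `Λ₁ = (klScale klE0 1) = e₀/4`
# (twin of p3 g8's `…EngineScaleZeroAlphaW` + `…AlphaWX5` one scale lower)

Cell gate-hubbard-kl, seat p3 (g20); VL lead k3c4-p1 g18 (HE1-GRANULARITY-g18.md §2″).  As at `e₀`: the pair weight splits
(`gridLabelWt_legPair_eq_split`) into PLAIN (`rowSum/colSum_scaleOne_le_A1`, F4), TIME (the Literature time moment
`timeMoment_charSum_uvSymbolCT_le` read at `Λ₁` — `timeMoment_scaleOne_of_frameOK/_of_klEng`, this file §0, constant `uvTimeMomentConst Λ₁ 7 32`)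
and SPACE (`spaceMoment_scaleOne_of_frameOK`, F5a, both directions) parts, the last two transported to the grid by
`HubbardGridCharactersWeighted.sum_norm_mul_gridSub_pullback_row/col_le_of_weight`.  Result:

* `timeMoment_scaleOne_of_frameOK`, `timeMoment_scaleOne_of_klEng` — `(β/N)·Σ (β/N)|ã|‖S[G]‖ ≤ uvTimeMomentConst Λ₁ 7 32`;
* **`rowSum_scaleOne_gridLabelWt_le`** / **`colSum_scaleOne_gridLabelWt_le`** — for an admissible frame (`FrameOK R U Nsc μ K`, `R.WF`, `|U| ≤ 1`),
  `klBetaMin ≤ β`, `klEngL₃ β U ≤ L`, `klEngM₃ β U L ≤ M`, cutoff derivatives `≤ B` up to order `5` (`1 ≤ B`), on the `N = 4M` grid: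
  `Σ_Y ‖(S_NᵀC^K_{>Λ₁}S_N) X Y‖·gridLabelWt L N β {gridLegPos X, gridLegPos Y} ≤ (N/β)·(A0₁ + uvTimeMomentConst Λ₁ 7 32 + 2·X_R,₁(B,U,Nsc))`;
* **`rowSum_scaleOne_gridLabelWt_le_X5`** / **`colSum_scaleOne_gridLabelWt_le_X5`** — the same at the definite cutoff bound `klCutoffX5` (no `B`).

Everything is proved; no definitions, no named facts, no sorry.  [cite: BenfattoGiulianiMastropietro2006, Lemma 2.2 (2.52), §2.7 (2.81)]
-/

noncomputable section

namespace Summit.HubbardSuperconductivity.HubbardSuperconductivity.Theorems.EngineV8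

set_option linter.dupNamespace false -- summit = problem name (single-conjunct summit), D-0017

open Real Finset Literature.MathematicalPhysics.QuantumLattice Literature.Probability.LatticeModels
open Literature.MathematicalPhysics.QuantumLattice.FermiRG
open Summit.HubbardSuperconductivity.HubbardSuperconductivity.Theorems.KLRegimeSplit
open Summit.HubbardSuperconductivity.HubbardSuperconductivity.Theorems.KLProgrammeLegKernels
open Summit.HubbardSuperconductivity.HubbardSuperconductivity.Theorems.DispersionFlow
open Summit.HubbardSuperconductivity.HubbardSuperconductivity.Theorems.ScaleZeroDecay

variable {L M : ℕ} [NeZero L] [NeZero M] {R : RenConsts} {U β μ : ℝ} {Nsc : ℕ} {K : TrigPolyC4v}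

/-! ## §0 The time moment at `Λ₁` -/

omit [NeZero M] in
/-- **The time moment of the cutoff-`Λ₁` covariance of an admissible frame is `O(1)` in the grid units**: for `FrameOK`, `klBetaMin ≤ β`,
`β³ ≤ M`, `2M ≤ N`, every spin `σ`,
`(β/N)·Σ_{a,b⃗} (β/N)·|ã|·‖Σ_{q₀,q⃗} χ_{q₀}(a)χ_{q⃗}(b⃗)·gridSymbol(uvSymbolCT … Λ₁) σ q₀ q⃗‖ ≤ uvTimeMomentConst Λ₁ 7 32` (Literature
`timeMoment_charSum_uvSymbolCT_le` at `Λ = Λ₁`, `D = 7` from `uvSurfaceBound_of_frameOK`, `R = 32`). -/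
theorem timeMoment_scaleOne_of_frameOK {N : ℕ} [NeZero N] (hK : FrameOK R U Nsc μ K) (hβ : klBetaMin ≤ β) (hβM : β ^ 3 ≤ (M : ℝ))
    (hMN : 2 * M ≤ N) (σ : Fin 2) :
    β / N * ∑ a : TorusSite 1 N, ∑ bv : TorusSite 2 L,
        β / N * |(((a 0).valMinAbs : ℤ) : ℝ)| *
          ‖∑ q₀ : TorusSite 1 N, ∑ qv : TorusSite 2 L,
            torusChar q₀ a * torusChar qv bv * gridSymbol L M N β (uvSymbolCT L M β μ K (klScale klE0 1)) σ q₀ qv‖ ≤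
      uvTimeMomentConst (klScale klE0 1) 7 32 := by
  have hβ2 : (2 : ℝ) ≤ β := le_trans (by norm_num [klBetaMin]) hβ
  exact timeMoment_charSum_uvSymbolCT_le hβ2 (by norm_num [klE0, klScale]) (by norm_num) (uvSurfaceBound_of_frameOK hK) hβM hMN
    (by norm_num) σ

omit [NeZero M] in
/-- The same under the engine's thresholds `klEngL₃ β U ≤ L`, `klEngM₃ β U L ≤ M` (which give `β³ ≤ M`). -/
theorem timeMoment_scaleOne_of_klEng {N : ℕ} [NeZero N] (hK : FrameOK R U Nsc μ K) (hβ : klBetaMin ≤ β) (hL : klEngL₃ β U ≤ L)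
    (hM : klEngM₃ β U L ≤ M) (hMN : 2 * M ≤ N) (σ : Fin 2) :
    β / N * ∑ a : TorusSite 1 N, ∑ bv : TorusSite 2 L,
        β / N * |(((a 0).valMinAbs : ℤ) : ℝ)| *
          ‖∑ q₀ : TorusSite 1 N, ∑ qv : TorusSite 2 L,
            torusChar q₀ a * torusChar qv bv * gridSymbol L M N β (uvSymbolCT L M β μ K (klScale klE0 1)) σ q₀ qv‖ ≤
      uvTimeMomentConst (klScale klE0 1) 7 32 :=
  timeMoment_scaleOne_of_frameOK hK hβ (pow_three_le_of_klEng hβ hL hM) hMN σ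

/-! ## §1 The centred time weight -/

/-- `cyclicDist_N(a, 0) = |ã|` (centred representative). -/
private theorem cyclicDist_zero_eq_abs_valMinAbs_one {N : ℕ} [NeZero N] (a : ZMod N) : cyclicDist N a 0 = |((a.valMinAbs : ℤ) : ℝ)| := by
  rw [cyclicDist, sub_zero, ← ZMod.valMinAbs_natAbs_eq_min, Nat.cast_natAbs, Int.cast_abs]

/-! ## §2 The weighted row and column sums -/

section AlphaW

variable [h4 : NeZero (2 * (2 * M))]

/-- **`hrow ≤ α_w`** — the `gridLabelWt`-weighted row sums of the pulled-back scale-`0` covariance of an admissible frame on the `4M` grid: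
`Σ_Y ‖(S_NᵀC^K_{>e₀}S_N) X Y‖·wt{pos X, pos Y} ≤ (N/β)·((14 * Real.sqrt ((1 / 2 + 12 / (klScale klE0 1)) *
            (2 / (klScale klE0 1) + 128 * Real.pi ^ 4 * (4 * (1110 : ℝ) + 6 * (32 / 3) + 2) ^ 2 / (klScale klE0 1) +
              2 * Real.pi ^ 5 * (4 * (1110 : ℝ) + 6 * (32 / 3) + 2) ^ 2 / (klScale klE0 1) ^ 2 + 1 +
              Real.pi ^ 4 * ((7 : ℝ) ^ 2 * (4 * (1110 : ℝ) + 6 * (32 / 3) + 2) * (2 / (klScale klE0 1)) + 7 * (2 * (32 / 3) + 1)) ^ 2 /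
                (klScale klE0 1) ^ 3))) + uvTimeMomentConst (klScale klE0 1) 7 32 + 2·X_R)` (plain + time + space). -/
theorem rowSum_scaleOne_gridLabelWt_le (hK : FrameOK R U Nsc μ K) (hR : R.WF) (hU1 : |U| ≤ 1) (hβ : klBetaMin ≤ β)
    (hL : klEngL₃ β U ≤ L) (hM : klEngM₃ β U L ≤ M) {B : ℝ} (hB1 : 1 ≤ B) (hB : ∀ i ≤ 5, ∀ t, ‖iteratedDeriv i salmhoferCutoff t‖ ≤ B)
    (X : GridLeg (GridPoint L (2 * (2 * M)))) :
    ∑ Y : GridLeg (GridPoint L (2 * (2 * M))),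
        ‖((hubbardGridSub L M β (2 * (2 * M))).transpose * hubbardCovAboveCT L M β μ 0 K (klScale klE0 1) * hubbardGridSub L M β (2 * (2 * M))) X Y‖ *
          gridLabelWt L (2 * (2 * M)) β {gridLegPos X, gridLegPos Y} ≤
      (((2 * (2 * M) : ℕ) : ℝ)) / β *
        ((14 * Real.sqrt ((1 / 2 + 12 / (klScale klE0 1)) *
            (2 / (klScale klE0 1) + 128 * Real.pi ^ 4 * (4 * (1110 : ℝ) + 6 * (32 / 3) + 2) ^ 2 / (klScale klE0 1) +
              2 * Real.pi ^ 5 * (4 * (1110 : ℝ) + 6 * (32 / 3) + 2) ^ 2 / (klScale klE0 1) ^ 2 + 1 +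
              Real.pi ^ 4 * ((7 : ℝ) ^ 2 * (4 * (1110 : ℝ) + 6 * (32 / 3) + 2) * (2 / (klScale klE0 1)) + 7 * (2 * (32 / 3) + 1)) ^ 2 /
                (klScale klE0 1) ^ 3))) + uvTimeMomentConst (klScale klE0 1) 7 32 +
          2 * (uvSpaceMomentConst (klScale klE0 1) 1 (uvPieceSq (klScale klE0 1) (uvBaseQ B (klScale klE0 1) 4) (uvBaseQ' B (klScale klE0 1) 4)) +
            (1 / 4 * Real.sqrt (216 * (1 / (klScale klE0 1) + 1 / 2)) *
                ∑ e : Fin 2 × Fin 2, (uvLinV (klScale klE0 1) (1 + (e.1 : ℕ) + (e.2 : ℕ)) *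
                    (B * ((1 + ((e.1 : ℕ) + (e.2 : ℕ)) + 2).factorial : ℝ) * (4 / (klScale klE0 1)) ^ (1 + ((e.1 : ℕ) + (e.2 : ℕ)) + 1)) +
                  uvLinD (klScale klE0 1) (1 + (e.1 : ℕ) + (e.2 : ℕ)) *
                    (B * ((1 + ((e.1 : ℕ) + (e.2 : ℕ)) + 3).factorial : ℝ) * (4 / (klScale klE0 1)) ^ (1 + ((e.1 : ℕ) + (e.2 : ℕ)) + 2)))) *
              (4608 * (1 + R.Gfr 0 + R.Gfr 1 + R.Gfr 2 + R.Gfr 3) ^ 4 * (((Nsc : ℝ) + 1) * U ^ 2 + 2 * |U|)))) := by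
  have hβ0 : 0 < β := beta_pos_of_klBetaMin_le hβ
  have hβM : β ^ 3 ≤ (M : ℝ) := pow_three_le_of_klEng hβ hL hM
  have hMN : 2 * M ≤ 2 * (2 * M) := by omega
  have hNgpos : 0 < (((2 * (2 * M) : ℕ) : ℝ)) := by have := NeZero.ne M; positivity
  set G := (hubbardGridSub L M β (2 * (2 * M))).transpose * hubbardCovAboveCT L M β μ 0 K (klScale klE0 1) * hubbardGridSub L M β (2 * (2 * M)) with hGdef
  have hGn : G = (hubbardGridSub L M β (2 * (2 * M))).transpose * normalCovariance L M (uvSymbolCT L M β μ K (klScale klE0 1)) * hubbardGridSub L M β (2 * (2 * M)) := by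
    rw [hGdef, hubbardCovAboveCT_zero_seed_eq_normalCovariance_uvSymbolCT]
  -- abbreviations for the three constants
  set T : ℝ := uvTimeMomentConst (klScale klE0 1) 7 32 with hT
  set XR : ℝ := uvSpaceMomentConst (klScale klE0 1) 1 (uvPieceSq (klScale klE0 1) (uvBaseQ B (klScale klE0 1) 4) (uvBaseQ' B (klScale klE0 1) 4)) +
      (1 / 4 * Real.sqrt (216 * (1 / (klScale klE0 1) + 1 / 2)) *
          ∑ e : Fin 2 × Fin 2, (uvLinV (klScale klE0 1) (1 + (e.1 : ℕ) + (e.2 : ℕ)) *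
              (B * ((1 + ((e.1 : ℕ) + (e.2 : ℕ)) + 2).factorial : ℝ) * (4 / (klScale klE0 1)) ^ (1 + ((e.1 : ℕ) + (e.2 : ℕ)) + 1)) +
            uvLinD (klScale klE0 1) (1 + (e.1 : ℕ) + (e.2 : ℕ)) *
              (B * ((1 + ((e.1 : ℕ) + (e.2 : ℕ)) + 3).factorial : ℝ) * (4 / (klScale klE0 1)) ^ (1 + ((e.1 : ℕ) + (e.2 : ℕ)) + 2)))) *
        (4608 * (1 + R.Gfr 0 + R.Gfr 1 + R.Gfr 2 + R.Gfr 3) ^ 4 * (((Nsc : ℝ) + 1) * U ^ 2 + 2 * |U|)) with hXR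
  -- (1) the plain part
  have hplain : ∑ Y : GridLeg (GridPoint L (2 * (2 * M))), ‖G X Y‖ ≤ (((2 * (2 * M) : ℕ) : ℝ)) / β * (14 * Real.sqrt ((1 / 2 + 12 / (klScale klE0 1)) *
            (2 / (klScale klE0 1) + 128 * Real.pi ^ 4 * (4 * (1110 : ℝ) + 6 * (32 / 3) + 2) ^ 2 / (klScale klE0 1) +
              2 * Real.pi ^ 5 * (4 * (1110 : ℝ) + 6 * (32 / 3) + 2) ^ 2 / (klScale klE0 1) ^ 2 + 1 +
              Real.pi ^ 4 * ((7 : ℝ) ^ 2 * (4 * (1110 : ℝ) + 6 * (32 / 3) + 2) * (2 / (klScale klE0 1)) + 7 * (2 * (32 / 3) + 1)) ^ 2 /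
                (klScale klE0 1) ^ 3))) := rowSum_scaleOne_le_A1 (L := L) hK hβ hβM X
  -- (2) the time part, from the torus time moment
  have hTsum : ∀ σ : Fin 2, ∑ a : TorusSite 1 (2 * (2 * M)), ∑ bv : TorusSite 2 L,
      (β / (((2 * (2 * M) : ℕ) : ℝ)) * cyclicDist (2 * (2 * M)) (a 0) 0) * ‖∑ q₀ : TorusSite 1 (2 * (2 * M)), ∑ qv : TorusSite 2 L, torusChar q₀ a * torusChar qv bv *
        gridSymbol L M (2 * (2 * M)) β (uvSymbolCT L M β μ K (klScale klE0 1)) σ q₀ qv‖ ≤ (((2 * (2 * M) : ℕ) : ℝ)) / β * T := by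
    intro σ
    have h := timeMoment_scaleOne_of_klEng (L := L) (N := (2 * (2 * M))) hK hβ hL hM hMN σ
    simp_rw [cyclicDist_zero_eq_abs_valMinAbs_one]
    rw [show (((2 * (2 * M) : ℕ) : ℝ)) / β * T = (β / (((2 * (2 * M) : ℕ) : ℝ)))⁻¹ * T by rw [inv_div]]
    exact (le_inv_mul_iff₀ (by positivity)).2 h
  have htime : ∑ Y : GridLeg (GridPoint L (2 * (2 * M))), ‖G X Y‖ *
      (β / (((2 * (2 * M) : ℕ) : ℝ)) * cyclicDist (2 * (2 * M)) (((X.1.1.1 : ℕ) : ZMod (2 * (2 * M))) - ((Y.1.1.1 : ℕ) : ZMod (2 * (2 * M)))) 0) ≤ (((2 * (2 * M) : ℕ) : ℝ)) / β * T := by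
    have h := sum_norm_mul_gridSub_pullback_row_le_of_weight (L := L) (M := M) (N := (2 * (2 * M))) hβ0.ne' hMN (uvSymbolCT L M β μ K (klScale klE0 1))
      (fun a _ => β / (((2 * (2 * M) : ℕ) : ℝ)) * cyclicDist (2 * (2 * M)) (a 0) 0) (fun a bv => by simp only [Pi.neg_apply, cyclicDist_neg_zero]) hTsum X
    rw [hGn]
    simpa only using h
  -- (3) the space part, from the torus space moments in both directions
  have hXsum : ∀ σ : Fin 2, ∑ a : TorusSite 1 (2 * (2 * M)), ∑ bv : TorusSite 2 L,
      torusSiteDist bv 0 * ‖∑ q₀ : TorusSite 1 (2 * (2 * M)), ∑ qv : TorusSite 2 L, torusChar q₀ a * torusChar qv bv *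
        gridSymbol L M (2 * (2 * M)) β (uvSymbolCT L M β μ K (klScale klE0 1)) σ q₀ qv‖ ≤ (((2 * (2 * M) : ℕ) : ℝ)) / β * (2 * XR) := by
    intro σ
    have h0 := spaceMoment_scaleOne_of_frameOK (L := L) (N := (2 * (2 * M))) hK hR hU1 hβ hβM hMN hB1 hB (l := 0) (l' := 1) (by decide) σ
    have h1 := spaceMoment_scaleOne_of_frameOK (L := L) (N := (2 * (2 * M))) hK hR hU1 hβ hβM hMN hB1 hB (l := 1) (l' := 0) (by decide) σ
    have hsum : β / (((2 * (2 * M) : ℕ) : ℝ)) * ∑ a : TorusSite 1 (2 * (2 * M)), ∑ bv : TorusSite 2 L,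
        (|(((bv 0).valMinAbs : ℤ) : ℝ)| + |(((bv 1).valMinAbs : ℤ) : ℝ)|) *
          ‖∑ q₀ : TorusSite 1 (2 * (2 * M)), ∑ qv : TorusSite 2 L, torusChar q₀ a * torusChar qv bv *
            gridSymbol L M (2 * (2 * M)) β (uvSymbolCT L M β μ K (klScale klE0 1)) σ q₀ qv‖ ≤ 2 * XR := by
      rw [hXR]
      have : β / (((2 * (2 * M) : ℕ) : ℝ)) * ∑ a : TorusSite 1 (2 * (2 * M)), ∑ bv : TorusSite 2 L,
          (|(((bv 0).valMinAbs : ℤ) : ℝ)| + |(((bv 1).valMinAbs : ℤ) : ℝ)|) *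
            ‖∑ q₀ : TorusSite 1 (2 * (2 * M)), ∑ qv : TorusSite 2 L, torusChar q₀ a * torusChar qv bv *
              gridSymbol L M (2 * (2 * M)) β (uvSymbolCT L M β μ K (klScale klE0 1)) σ q₀ qv‖ =
          β / (((2 * (2 * M) : ℕ) : ℝ)) * ∑ a : TorusSite 1 (2 * (2 * M)), ∑ bv : TorusSite 2 L, |(((bv 0).valMinAbs : ℤ) : ℝ)| *
              ‖∑ q₀ : TorusSite 1 (2 * (2 * M)), ∑ qv : TorusSite 2 L, torusChar q₀ a * torusChar qv bv *
                gridSymbol L M (2 * (2 * M)) β (uvSymbolCT L M β μ K (klScale klE0 1)) σ q₀ qv‖ +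
            β / (((2 * (2 * M) : ℕ) : ℝ)) * ∑ a : TorusSite 1 (2 * (2 * M)), ∑ bv : TorusSite 2 L, |(((bv 1).valMinAbs : ℤ) : ℝ)| *
              ‖∑ q₀ : TorusSite 1 (2 * (2 * M)), ∑ qv : TorusSite 2 L, torusChar q₀ a * torusChar qv bv *
                gridSymbol L M (2 * (2 * M)) β (uvSymbolCT L M β μ K (klScale klE0 1)) σ q₀ qv‖ := by
        rw [← mul_add, ← sum_add_distrib]
        congr 1
        refine sum_congr rfl fun a _ => ?_
        rw [← sum_add_distrib]
        exact sum_congr rfl fun bv _ => by ring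
      rw [this]
      linarith
    have hle : ∑ a : TorusSite 1 (2 * (2 * M)), ∑ bv : TorusSite 2 L,
        torusSiteDist bv 0 * ‖∑ q₀ : TorusSite 1 (2 * (2 * M)), ∑ qv : TorusSite 2 L, torusChar q₀ a * torusChar qv bv *
          gridSymbol L M (2 * (2 * M)) β (uvSymbolCT L M β μ K (klScale klE0 1)) σ q₀ qv‖ ≤
        ∑ a : TorusSite 1 (2 * (2 * M)), ∑ bv : TorusSite 2 L, (|(((bv 0).valMinAbs : ℤ) : ℝ)| + |(((bv 1).valMinAbs : ℤ) : ℝ)|) *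
          ‖∑ q₀ : TorusSite 1 (2 * (2 * M)), ∑ qv : TorusSite 2 L, torusChar q₀ a * torusChar qv bv *
            gridSymbol L M (2 * (2 * M)) β (uvSymbolCT L M β μ K (klScale klE0 1)) σ q₀ qv‖ := by
      refine sum_le_sum fun a _ => sum_le_sum fun bv _ => mul_le_mul_of_nonneg_right ?_ (norm_nonneg _)
      have h := torusSiteDist_le_abs_add_abs bv 0
      rwa [sub_zero] at h
    calc _ ≤ _ := hle
      _ ≤ (β / (((2 * (2 * M) : ℕ) : ℝ)))⁻¹ * (2 * XR) := (le_inv_mul_iff₀ (by positivity)).2 hsum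
      _ = (((2 * (2 * M) : ℕ) : ℝ)) / β * (2 * XR) := by rw [inv_div]
  have hspace : ∑ Y : GridLeg (GridPoint L (2 * (2 * M))), ‖G X Y‖ * torusSiteDist (X.1.1.2 - Y.1.1.2) 0 ≤ (((2 * (2 * M) : ℕ) : ℝ)) / β * (2 * XR) := by
    have h := sum_norm_mul_gridSub_pullback_row_le_of_weight (L := L) (M := M) (N := (2 * (2 * M))) hβ0.ne' hMN (uvSymbolCT L M β μ K (klScale klE0 1))
      (fun _ bv => torusSiteDist bv 0) (fun a bv => by simp only [torusSiteDist_neg_zero]) hXsum X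
    rw [hGn]
    simpa only using h
  -- assemble
  have hsplit : ∀ Y : GridLeg (GridPoint L (2 * (2 * M))), ‖G X Y‖ * gridLabelWt L (2 * (2 * M)) β {gridLegPos X, gridLegPos Y} =
      ‖G X Y‖ + ‖G X Y‖ * (β / (((2 * (2 * M) : ℕ) : ℝ)) * cyclicDist (2 * (2 * M)) (((X.1.1.1 : ℕ) : ZMod (2 * (2 * M))) - ((Y.1.1.1 : ℕ) : ZMod (2 * (2 * M)))) 0) +
        ‖G X Y‖ * torusSiteDist (X.1.1.2 - Y.1.1.2) 0 := by
    intro Y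
    rw [gridLabelWt_legPair_eq_split hβ0.le X Y]
    ring
  rw [sum_congr rfl fun Y _ => hsplit Y, sum_add_distrib, sum_add_distrib]
  have htot : (((2 * (2 * M) : ℕ) : ℝ)) / β * (14 * Real.sqrt ((1 / 2 + 12 / (klScale klE0 1)) *
            (2 / (klScale klE0 1) + 128 * Real.pi ^ 4 * (4 * (1110 : ℝ) + 6 * (32 / 3) + 2) ^ 2 / (klScale klE0 1) +
              2 * Real.pi ^ 5 * (4 * (1110 : ℝ) + 6 * (32 / 3) + 2) ^ 2 / (klScale klE0 1) ^ 2 + 1 +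
              Real.pi ^ 4 * ((7 : ℝ) ^ 2 * (4 * (1110 : ℝ) + 6 * (32 / 3) + 2) * (2 / (klScale klE0 1)) + 7 * (2 * (32 / 3) + 1)) ^ 2 /
                (klScale klE0 1) ^ 3))) + (((2 * (2 * M) : ℕ) : ℝ)) / β * T + (((2 * (2 * M) : ℕ) : ℝ)) / β * (2 * XR) =
      (((2 * (2 * M) : ℕ) : ℝ)) / β * ((14 * Real.sqrt ((1 / 2 + 12 / (klScale klE0 1)) *
            (2 / (klScale klE0 1) + 128 * Real.pi ^ 4 * (4 * (1110 : ℝ) + 6 * (32 / 3) + 2) ^ 2 / (klScale klE0 1) +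
              2 * Real.pi ^ 5 * (4 * (1110 : ℝ) + 6 * (32 / 3) + 2) ^ 2 / (klScale klE0 1) ^ 2 + 1 +
              Real.pi ^ 4 * ((7 : ℝ) ^ 2 * (4 * (1110 : ℝ) + 6 * (32 / 3) + 2) * (2 / (klScale klE0 1)) + 7 * (2 * (32 / 3) + 1)) ^ 2 /
                (klScale klE0 1) ^ 3))) + T + 2 * XR) := by ring
  rw [← htot]
  exact add_le_add (add_le_add hplain htime) hspace

/-- **`hcol ≤ α_w`** — the same bound for the weighted column sums. -/
theorem colSum_scaleOne_gridLabelWt_le (hK : FrameOK R U Nsc μ K) (hR : R.WF) (hU1 : |U| ≤ 1) (hβ : klBetaMin ≤ β)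
    (hL : klEngL₃ β U ≤ L) (hM : klEngM₃ β U L ≤ M) {B : ℝ} (hB1 : 1 ≤ B) (hB : ∀ i ≤ 5, ∀ t, ‖iteratedDeriv i salmhoferCutoff t‖ ≤ B)
    (Y : GridLeg (GridPoint L (2 * (2 * M)))) :
    ∑ X : GridLeg (GridPoint L (2 * (2 * M))),
        ‖((hubbardGridSub L M β (2 * (2 * M))).transpose * hubbardCovAboveCT L M β μ 0 K (klScale klE0 1) * hubbardGridSub L M β (2 * (2 * M))) X Y‖ *
          gridLabelWt L (2 * (2 * M)) β {gridLegPos X, gridLegPos Y} ≤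
      (((2 * (2 * M) : ℕ) : ℝ)) / β *
        ((14 * Real.sqrt ((1 / 2 + 12 / (klScale klE0 1)) *
            (2 / (klScale klE0 1) + 128 * Real.pi ^ 4 * (4 * (1110 : ℝ) + 6 * (32 / 3) + 2) ^ 2 / (klScale klE0 1) +
              2 * Real.pi ^ 5 * (4 * (1110 : ℝ) + 6 * (32 / 3) + 2) ^ 2 / (klScale klE0 1) ^ 2 + 1 +
              Real.pi ^ 4 * ((7 : ℝ) ^ 2 * (4 * (1110 : ℝ) + 6 * (32 / 3) + 2) * (2 / (klScale klE0 1)) + 7 * (2 * (32 / 3) + 1)) ^ 2 /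
                (klScale klE0 1) ^ 3))) + uvTimeMomentConst (klScale klE0 1) 7 32 +
          2 * (uvSpaceMomentConst (klScale klE0 1) 1 (uvPieceSq (klScale klE0 1) (uvBaseQ B (klScale klE0 1) 4) (uvBaseQ' B (klScale klE0 1) 4)) +
            (1 / 4 * Real.sqrt (216 * (1 / (klScale klE0 1) + 1 / 2)) *
                ∑ e : Fin 2 × Fin 2, (uvLinV (klScale klE0 1) (1 + (e.1 : ℕ) + (e.2 : ℕ)) *
                    (B * ((1 + ((e.1 : ℕ) + (e.2 : ℕ)) + 2).factorial : ℝ) * (4 / (klScale klE0 1)) ^ (1 + ((e.1 : ℕ) + (e.2 : ℕ)) + 1)) +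
                  uvLinD (klScale klE0 1) (1 + (e.1 : ℕ) + (e.2 : ℕ)) *
                    (B * ((1 + ((e.1 : ℕ) + (e.2 : ℕ)) + 3).factorial : ℝ) * (4 / (klScale klE0 1)) ^ (1 + ((e.1 : ℕ) + (e.2 : ℕ)) + 2)))) *
              (4608 * (1 + R.Gfr 0 + R.Gfr 1 + R.Gfr 2 + R.Gfr 3) ^ 4 * (((Nsc : ℝ) + 1) * U ^ 2 + 2 * |U|)))) := by
  have hβ0 : 0 < β := beta_pos_of_klBetaMin_le hβ
  have hβM : β ^ 3 ≤ (M : ℝ) := pow_three_le_of_klEng hβ hL hM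
  have hMN : 2 * M ≤ 2 * (2 * M) := by omega
  have hNgpos : 0 < (((2 * (2 * M) : ℕ) : ℝ)) := by have := NeZero.ne M; positivity
  set G := (hubbardGridSub L M β (2 * (2 * M))).transpose * hubbardCovAboveCT L M β μ 0 K (klScale klE0 1) * hubbardGridSub L M β (2 * (2 * M)) with hGdef
  have hGn : G = (hubbardGridSub L M β (2 * (2 * M))).transpose * normalCovariance L M (uvSymbolCT L M β μ K (klScale klE0 1)) * hubbardGridSub L M β (2 * (2 * M)) := by
    rw [hGdef, hubbardCovAboveCT_zero_seed_eq_normalCovariance_uvSymbolCT]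
  set T : ℝ := uvTimeMomentConst (klScale klE0 1) 7 32 with hT
  set XR : ℝ := uvSpaceMomentConst (klScale klE0 1) 1 (uvPieceSq (klScale klE0 1) (uvBaseQ B (klScale klE0 1) 4) (uvBaseQ' B (klScale klE0 1) 4)) +
      (1 / 4 * Real.sqrt (216 * (1 / (klScale klE0 1) + 1 / 2)) *
          ∑ e : Fin 2 × Fin 2, (uvLinV (klScale klE0 1) (1 + (e.1 : ℕ) + (e.2 : ℕ)) *
              (B * ((1 + ((e.1 : ℕ) + (e.2 : ℕ)) + 2).factorial : ℝ) * (4 / (klScale klE0 1)) ^ (1 + ((e.1 : ℕ) + (e.2 : ℕ)) + 1)) +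
            uvLinD (klScale klE0 1) (1 + (e.1 : ℕ) + (e.2 : ℕ)) *
              (B * ((1 + ((e.1 : ℕ) + (e.2 : ℕ)) + 3).factorial : ℝ) * (4 / (klScale klE0 1)) ^ (1 + ((e.1 : ℕ) + (e.2 : ℕ)) + 2)))) *
        (4608 * (1 + R.Gfr 0 + R.Gfr 1 + R.Gfr 2 + R.Gfr 3) ^ 4 * (((Nsc : ℝ) + 1) * U ^ 2 + 2 * |U|)) with hXR
  have hplain : ∑ X : GridLeg (GridPoint L (2 * (2 * M))), ‖G X Y‖ ≤ (((2 * (2 * M) : ℕ) : ℝ)) / β * (14 * Real.sqrt ((1 / 2 + 12 / (klScale klE0 1)) *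
            (2 / (klScale klE0 1) + 128 * Real.pi ^ 4 * (4 * (1110 : ℝ) + 6 * (32 / 3) + 2) ^ 2 / (klScale klE0 1) +
              2 * Real.pi ^ 5 * (4 * (1110 : ℝ) + 6 * (32 / 3) + 2) ^ 2 / (klScale klE0 1) ^ 2 + 1 +
              Real.pi ^ 4 * ((7 : ℝ) ^ 2 * (4 * (1110 : ℝ) + 6 * (32 / 3) + 2) * (2 / (klScale klE0 1)) + 7 * (2 * (32 / 3) + 1)) ^ 2 /
                (klScale klE0 1) ^ 3))) := colSum_scaleOne_le_A1 (L := L) hK hβ hβM Y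
  have hTsum : ∀ σ : Fin 2, ∑ a : TorusSite 1 (2 * (2 * M)), ∑ bv : TorusSite 2 L,
      (β / (((2 * (2 * M) : ℕ) : ℝ)) * cyclicDist (2 * (2 * M)) (a 0) 0) * ‖∑ q₀ : TorusSite 1 (2 * (2 * M)), ∑ qv : TorusSite 2 L, torusChar q₀ a * torusChar qv bv *
        gridSymbol L M (2 * (2 * M)) β (uvSymbolCT L M β μ K (klScale klE0 1)) σ q₀ qv‖ ≤ (((2 * (2 * M) : ℕ) : ℝ)) / β * T := by
    intro σ
    have h := timeMoment_scaleOne_of_klEng (L := L) (N := (2 * (2 * M))) hK hβ hL hM hMN σ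
    simp_rw [cyclicDist_zero_eq_abs_valMinAbs_one]
    rw [show (((2 * (2 * M) : ℕ) : ℝ)) / β * T = (β / (((2 * (2 * M) : ℕ) : ℝ)))⁻¹ * T by rw [inv_div]]
    exact (le_inv_mul_iff₀ (by positivity)).2 h
  have htime : ∑ X : GridLeg (GridPoint L (2 * (2 * M))), ‖G X Y‖ *
      (β / (((2 * (2 * M) : ℕ) : ℝ)) * cyclicDist (2 * (2 * M)) (((X.1.1.1 : ℕ) : ZMod (2 * (2 * M))) - ((Y.1.1.1 : ℕ) : ZMod (2 * (2 * M)))) 0) ≤ (((2 * (2 * M) : ℕ) : ℝ)) / β * T := by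
    have h := sum_norm_mul_gridSub_pullback_col_le_of_weight (L := L) (M := M) (N := (2 * (2 * M))) hβ0.ne' hMN (uvSymbolCT L M β μ K (klScale klE0 1))
      (fun a _ => β / (((2 * (2 * M) : ℕ) : ℝ)) * cyclicDist (2 * (2 * M)) (a 0) 0) (fun a bv => by simp only [Pi.neg_apply, cyclicDist_neg_zero]) hTsum Y
    rw [hGn]
    simpa only using h
  have hXsum : ∀ σ : Fin 2, ∑ a : TorusSite 1 (2 * (2 * M)), ∑ bv : TorusSite 2 L,
      torusSiteDist bv 0 * ‖∑ q₀ : TorusSite 1 (2 * (2 * M)), ∑ qv : TorusSite 2 L, torusChar q₀ a * torusChar qv bv *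
        gridSymbol L M (2 * (2 * M)) β (uvSymbolCT L M β μ K (klScale klE0 1)) σ q₀ qv‖ ≤ (((2 * (2 * M) : ℕ) : ℝ)) / β * (2 * XR) := by
    intro σ
    have h0 := spaceMoment_scaleOne_of_frameOK (L := L) (N := (2 * (2 * M))) hK hR hU1 hβ hβM hMN hB1 hB (l := 0) (l' := 1) (by decide) σ
    have h1 := spaceMoment_scaleOne_of_frameOK (L := L) (N := (2 * (2 * M))) hK hR hU1 hβ hβM hMN hB1 hB (l := 1) (l' := 0) (by decide) σ
    have hsum : β / (((2 * (2 * M) : ℕ) : ℝ)) * ∑ a : TorusSite 1 (2 * (2 * M)), ∑ bv : TorusSite 2 L,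
        (|(((bv 0).valMinAbs : ℤ) : ℝ)| + |(((bv 1).valMinAbs : ℤ) : ℝ)|) *
          ‖∑ q₀ : TorusSite 1 (2 * (2 * M)), ∑ qv : TorusSite 2 L, torusChar q₀ a * torusChar qv bv *
            gridSymbol L M (2 * (2 * M)) β (uvSymbolCT L M β μ K (klScale klE0 1)) σ q₀ qv‖ ≤ 2 * XR := by
      rw [hXR]
      have : β / (((2 * (2 * M) : ℕ) : ℝ)) * ∑ a : TorusSite 1 (2 * (2 * M)), ∑ bv : TorusSite 2 L,
          (|(((bv 0).valMinAbs : ℤ) : ℝ)| + |(((bv 1).valMinAbs : ℤ) : ℝ)|) *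
            ‖∑ q₀ : TorusSite 1 (2 * (2 * M)), ∑ qv : TorusSite 2 L, torusChar q₀ a * torusChar qv bv *
              gridSymbol L M (2 * (2 * M)) β (uvSymbolCT L M β μ K (klScale klE0 1)) σ q₀ qv‖ =
          β / (((2 * (2 * M) : ℕ) : ℝ)) * ∑ a : TorusSite 1 (2 * (2 * M)), ∑ bv : TorusSite 2 L, |(((bv 0).valMinAbs : ℤ) : ℝ)| *
              ‖∑ q₀ : TorusSite 1 (2 * (2 * M)), ∑ qv : TorusSite 2 L, torusChar q₀ a * torusChar qv bv *
                gridSymbol L M (2 * (2 * M)) β (uvSymbolCT L M β μ K (klScale klE0 1)) σ q₀ qv‖ +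
            β / (((2 * (2 * M) : ℕ) : ℝ)) * ∑ a : TorusSite 1 (2 * (2 * M)), ∑ bv : TorusSite 2 L, |(((bv 1).valMinAbs : ℤ) : ℝ)| *
              ‖∑ q₀ : TorusSite 1 (2 * (2 * M)), ∑ qv : TorusSite 2 L, torusChar q₀ a * torusChar qv bv *
                gridSymbol L M (2 * (2 * M)) β (uvSymbolCT L M β μ K (klScale klE0 1)) σ q₀ qv‖ := by
        rw [← mul_add, ← sum_add_distrib]
        congr 1
        refine sum_congr rfl fun a _ => ?_
        rw [← sum_add_distrib]
        exact sum_congr rfl fun bv _ => by ring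
      rw [this]
      linarith
    have hle : ∑ a : TorusSite 1 (2 * (2 * M)), ∑ bv : TorusSite 2 L,
        torusSiteDist bv 0 * ‖∑ q₀ : TorusSite 1 (2 * (2 * M)), ∑ qv : TorusSite 2 L, torusChar q₀ a * torusChar qv bv *
          gridSymbol L M (2 * (2 * M)) β (uvSymbolCT L M β μ K (klScale klE0 1)) σ q₀ qv‖ ≤
        ∑ a : TorusSite 1 (2 * (2 * M)), ∑ bv : TorusSite 2 L, (|(((bv 0).valMinAbs : ℤ) : ℝ)| + |(((bv 1).valMinAbs : ℤ) : ℝ)|) *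
          ‖∑ q₀ : TorusSite 1 (2 * (2 * M)), ∑ qv : TorusSite 2 L, torusChar q₀ a * torusChar qv bv *
            gridSymbol L M (2 * (2 * M)) β (uvSymbolCT L M β μ K (klScale klE0 1)) σ q₀ qv‖ := by
      refine sum_le_sum fun a _ => sum_le_sum fun bv _ => mul_le_mul_of_nonneg_right ?_ (norm_nonneg _)
      have h := torusSiteDist_le_abs_add_abs bv 0
      rwa [sub_zero] at h
    calc _ ≤ _ := hle
      _ ≤ (β / (((2 * (2 * M) : ℕ) : ℝ)))⁻¹ * (2 * XR) := (le_inv_mul_iff₀ (by positivity)).2 hsum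
      _ = (((2 * (2 * M) : ℕ) : ℝ)) / β * (2 * XR) := by rw [inv_div]
  have hspace : ∑ X : GridLeg (GridPoint L (2 * (2 * M))), ‖G X Y‖ * torusSiteDist (X.1.1.2 - Y.1.1.2) 0 ≤ (((2 * (2 * M) : ℕ) : ℝ)) / β * (2 * XR) := by
    have h := sum_norm_mul_gridSub_pullback_col_le_of_weight (L := L) (M := M) (N := (2 * (2 * M))) hβ0.ne' hMN (uvSymbolCT L M β μ K (klScale klE0 1))
      (fun _ bv => torusSiteDist bv 0) (fun a bv => by simp only [torusSiteDist_neg_zero]) hXsum Y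
    rw [hGn]
    simpa only using h
  have hsplit : ∀ X : GridLeg (GridPoint L (2 * (2 * M))), ‖G X Y‖ * gridLabelWt L (2 * (2 * M)) β {gridLegPos X, gridLegPos Y} =
      ‖G X Y‖ + ‖G X Y‖ * (β / (((2 * (2 * M) : ℕ) : ℝ)) * cyclicDist (2 * (2 * M)) (((X.1.1.1 : ℕ) : ZMod (2 * (2 * M))) - ((Y.1.1.1 : ℕ) : ZMod (2 * (2 * M)))) 0) +
        ‖G X Y‖ * torusSiteDist (X.1.1.2 - Y.1.1.2) 0 := by
    intro X
    rw [gridLabelWt_legPair_eq_split hβ0.le X Y]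
    ring
  rw [sum_congr rfl fun X _ => hsplit X, sum_add_distrib, sum_add_distrib]
  have htot : (((2 * (2 * M) : ℕ) : ℝ)) / β * (14 * Real.sqrt ((1 / 2 + 12 / (klScale klE0 1)) *
            (2 / (klScale klE0 1) + 128 * Real.pi ^ 4 * (4 * (1110 : ℝ) + 6 * (32 / 3) + 2) ^ 2 / (klScale klE0 1) +
              2 * Real.pi ^ 5 * (4 * (1110 : ℝ) + 6 * (32 / 3) + 2) ^ 2 / (klScale klE0 1) ^ 2 + 1 +
              Real.pi ^ 4 * ((7 : ℝ) ^ 2 * (4 * (1110 : ℝ) + 6 * (32 / 3) + 2) * (2 / (klScale klE0 1)) + 7 * (2 * (32 / 3) + 1)) ^ 2 /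
                (klScale klE0 1) ^ 3))) + (((2 * (2 * M) : ℕ) : ℝ)) / β * T + (((2 * (2 * M) : ℕ) : ℝ)) / β * (2 * XR) =
      (((2 * (2 * M) : ℕ) : ℝ)) / β * ((14 * Real.sqrt ((1 / 2 + 12 / (klScale klE0 1)) *
            (2 / (klScale klE0 1) + 128 * Real.pi ^ 4 * (4 * (1110 : ℝ) + 6 * (32 / 3) + 2) ^ 2 / (klScale klE0 1) +
              2 * Real.pi ^ 5 * (4 * (1110 : ℝ) + 6 * (32 / 3) + 2) ^ 2 / (klScale klE0 1) ^ 2 + 1 +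
              Real.pi ^ 4 * ((7 : ℝ) ^ 2 * (4 * (1110 : ℝ) + 6 * (32 / 3) + 2) * (2 / (klScale klE0 1)) + 7 * (2 * (32 / 3) + 1)) ^ 2 /
                (klScale klE0 1) ^ 3))) + T + 2 * XR) := by ring
  rw [← htot]
  exact add_le_add (add_le_add hplain htime) hspace

end AlphaW

section AlphaWX5

variable [h4 : NeZero (2 * (2 * M))]

/-- **`hrow ≤ α_w` at the definite cutoff bound `klCutoffX5`** (no `B` hypothesis). -/
theorem rowSum_scaleOne_gridLabelWt_le_X5 (hK : FrameOK R U Nsc μ K) (hR : R.WF) (hU1 : |U| ≤ 1) (hβ : klBetaMin ≤ β)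
    (hL : klEngL₃ β U ≤ L) (hM : klEngM₃ β U L ≤ M) (X : GridLeg (GridPoint L (2 * (2 * M)))) :
    ∑ Y : GridLeg (GridPoint L (2 * (2 * M))),
        ‖((hubbardGridSub L M β (2 * (2 * M))).transpose * hubbardCovAboveCT L M β μ 0 K (klScale klE0 1) * hubbardGridSub L M β (2 * (2 * M))) X Y‖ *
          gridLabelWt L (2 * (2 * M)) β {gridLegPos X, gridLegPos Y} ≤
      (((2 * (2 * M) : ℕ) : ℝ)) / β *
        ((14 * Real.sqrt ((1 / 2 + 12 / (klScale klE0 1)) *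
            (2 / (klScale klE0 1) + 128 * Real.pi ^ 4 * (4 * (1110 : ℝ) + 6 * (32 / 3) + 2) ^ 2 / (klScale klE0 1) +
              2 * Real.pi ^ 5 * (4 * (1110 : ℝ) + 6 * (32 / 3) + 2) ^ 2 / (klScale klE0 1) ^ 2 + 1 +
              Real.pi ^ 4 * ((7 : ℝ) ^ 2 * (4 * (1110 : ℝ) + 6 * (32 / 3) + 2) * (2 / (klScale klE0 1)) + 7 * (2 * (32 / 3) + 1)) ^ 2 /
                (klScale klE0 1) ^ 3))) + uvTimeMomentConst (klScale klE0 1) 7 32 +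
          2 * (uvSpaceMomentConst (klScale klE0 1) 1 (uvPieceSq (klScale klE0 1) (uvBaseQ klCutoffX5 (klScale klE0 1) 4) (uvBaseQ' klCutoffX5 (klScale klE0 1) 4)) +
            (1 / 4 * Real.sqrt (216 * (1 / (klScale klE0 1) + 1 / 2)) *
                ∑ e : Fin 2 × Fin 2, (uvLinV (klScale klE0 1) (1 + (e.1 : ℕ) + (e.2 : ℕ)) *
                    (klCutoffX5 * ((1 + ((e.1 : ℕ) + (e.2 : ℕ)) + 2).factorial : ℝ) * (4 / (klScale klE0 1)) ^ (1 + ((e.1 : ℕ) + (e.2 : ℕ)) + 1)) +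
                  uvLinD (klScale klE0 1) (1 + (e.1 : ℕ) + (e.2 : ℕ)) *
                    (klCutoffX5 * ((1 + ((e.1 : ℕ) + (e.2 : ℕ)) + 3).factorial : ℝ) * (4 / (klScale klE0 1)) ^ (1 + ((e.1 : ℕ) + (e.2 : ℕ)) + 2)))) *
              (4608 * (1 + R.Gfr 0 + R.Gfr 1 + R.Gfr 2 + R.Gfr 3) ^ 4 * (((Nsc : ℝ) + 1) * U ^ 2 + 2 * |U|)))) :=
  rowSum_scaleOne_gridLabelWt_le hK hR hU1 hβ hL hM one_le_klCutoffX5 norm_iteratedDeriv_salmhoferCutoff_le_klCutoffX5 X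

/-- **`hcol ≤ α_w` at the definite cutoff bound `klCutoffX5`** (no `B` hypothesis). -/
theorem colSum_scaleOne_gridLabelWt_le_X5 (hK : FrameOK R U Nsc μ K) (hR : R.WF) (hU1 : |U| ≤ 1) (hβ : klBetaMin ≤ β)
    (hL : klEngL₃ β U ≤ L) (hM : klEngM₃ β U L ≤ M) (Y : GridLeg (GridPoint L (2 * (2 * M)))) :
    ∑ X : GridLeg (GridPoint L (2 * (2 * M))),
        ‖((hubbardGridSub L M β (2 * (2 * M))).transpose * hubbardCovAboveCT L M β μ 0 K (klScale klE0 1) * hubbardGridSub L M β (2 * (2 * M))) X Y‖ *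
          gridLabelWt L (2 * (2 * M)) β {gridLegPos X, gridLegPos Y} ≤
      (((2 * (2 * M) : ℕ) : ℝ)) / β *
        ((14 * Real.sqrt ((1 / 2 + 12 / (klScale klE0 1)) *
            (2 / (klScale klE0 1) + 128 * Real.pi ^ 4 * (4 * (1110 : ℝ) + 6 * (32 / 3) + 2) ^ 2 / (klScale klE0 1) +
              2 * Real.pi ^ 5 * (4 * (1110 : ℝ) + 6 * (32 / 3) + 2) ^ 2 / (klScale klE0 1) ^ 2 + 1 +
              Real.pi ^ 4 * ((7 : ℝ) ^ 2 * (4 * (1110 : ℝ) + 6 * (32 / 3) + 2) * (2 / (klScale klE0 1)) + 7 * (2 * (32 / 3) + 1)) ^ 2 /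
                (klScale klE0 1) ^ 3))) + uvTimeMomentConst (klScale klE0 1) 7 32 +
          2 * (uvSpaceMomentConst (klScale klE0 1) 1 (uvPieceSq (klScale klE0 1) (uvBaseQ klCutoffX5 (klScale klE0 1) 4) (uvBaseQ' klCutoffX5 (klScale klE0 1) 4)) +
            (1 / 4 * Real.sqrt (216 * (1 / (klScale klE0 1) + 1 / 2)) *
                ∑ e : Fin 2 × Fin 2, (uvLinV (klScale klE0 1) (1 + (e.1 : ℕ) + (e.2 : ℕ)) *
                    (klCutoffX5 * ((1 + ((e.1 : ℕ) + (e.2 : ℕ)) + 2).factorial : ℝ) * (4 / (klScale klE0 1)) ^ (1 + ((e.1 : ℕ) + (e.2 : ℕ)) + 1)) +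
                  uvLinD (klScale klE0 1) (1 + (e.1 : ℕ) + (e.2 : ℕ)) *
                    (klCutoffX5 * ((1 + ((e.1 : ℕ) + (e.2 : ℕ)) + 3).factorial : ℝ) * (4 / (klScale klE0 1)) ^ (1 + ((e.1 : ℕ) + (e.2 : ℕ)) + 2)))) *
              (4608 * (1 + R.Gfr 0 + R.Gfr 1 + R.Gfr 2 + R.Gfr 3) ^ 4 * (((Nsc : ℝ) + 1) * U ^ 2 + 2 * |U|)))) :=
  colSum_scaleOne_gridLabelWt_le hK hR hU1 hβ hL hM one_le_klCutoffX5 norm_iteratedDeriv_salmhoferCutoff_le_klCutoffX5 Y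

end AlphaWX5

end Summit.HubbardSuperconductivity.HubbardSuperconductivity.Theorems.EngineV8

end
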